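import Literature.IUT.HodgeArakelov.PlusMinusTowerNonVacuity
import Literature.IUT.HodgeArakelov.ThetaEvaluationSettingNegative
import HarnessLib

/-!
# [IUTchII] Prop 2.2 (ii), frozen v1 `Prop22_ii`: the universal closure AS TYPED is false (kernel witness)

S. Mochizuki, *Inter-universal Teichmüller theory II*, kurims manuscript (Dec. 2020), §2, Proposition 2.2 (ii)
p. 66 ("… determines a specific `μ_{2l}`-orbit `θ^ι(Π_v) ⊆ θ(Π_v)` within the unique `{(l·ℤ) × μ_{2l}}`-orbit
contained in the set `θ(Π_v)`") [cite: Mochizuki2012, II Prop 2.2 (ii) p.66]. Claim key `Mochizuki2012`,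
status DISPUTED (D-0012); this PROOF-ONLY companion of `ThetaEvaluationSetting.lean` (no `def`, no `instance`;
the frozen module is imported unchanged) asserts nothing of the series and takes no side on [IUTchIII]
Cor. 3.12.

FACT-LIST row **F-0675** (cell abc-iut, frozen plan/FACT-LIST.md; seat abc-iut-f-045, block F): the decl
`Literature.IUT.HodgeArakelov.Prop22_ii Dec := Nonempty (IotaInvariantTheta Dec)` (v1: a LITERAL `ι`-fixed point
in `θ(Π_v)`, all literal fixed points in one `μ_{2l}`-class). Its binders are the interfaces
`BadPlaceSetting`, `TopGroup`, `TemperedCoverings`, `EtaleThetaData`, `SubgraphDecomposition`, over which the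
cohomology `H¹(Π_Ÿ(Π_v), (l·Δ_Θ)(Π_v))` and the orbit `η̈^{Θ,l·ℤ×μ_2}` are FREE data. Kernel content:
* `IotaInvariantTheta.smul_sub_eq_zero_of_forall_fixed` — if the `ι` of a v1 datum fixes `θ(Π_v)` pointwise,
  then `θ(Π_v)` lies in ONE `2l`-torsion class;
* `not_prop22_ii_of_forall_fixed` — hence `Prop22_ii Dec` FAILS whenever every `θ`-preserving additive
  automorphism of `H¹` fixes `θ(Π_v)` pointwise while `θ(Π_v)` contains two classes `t, t'` with
  `2l·(t' − t) ≠ 0`;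
* `not_forall_prop22_ii` — the universal closure of F-0675 AS TYPED is FALSE: over the degenerate stack of
  `PlusMinusTower.nonempty_degenerate` (all groups trivial) take the Prop 1.4 output with `H¹ = lim = ℤ` and
  orbit `{0, 1}`, so `θ(Π_v) = {0, −1}`; an additive automorphism of `ℤ` preserving `{0, −1}` fixes it
  pointwise, and `2l·(−1) ≠ 0`.
Instance forms of record (cited, not restated): the v1 structure IS inhabited at trivial cohomology
(`IotaInvariantTheta.nonempty_degenerate`, `PlusMinusTowerNonVacuity.lean`) and is NOT witnessable by the
geometric `ι` at genuine data (`IotaInvariantTheta.false_of_fixedPointFree`, `IotaInvariantThetaNegative.lean`);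
the printed content is carried by the repair `Prop22_ii'` (`IotaInvariantThetaR.lean`, row F-0661) with its model
theorems (`prop22_ii'_model`, …). So F-0675 is a SCHEMA row: universal closure REFUTED here; no consumer takes
`Prop22_ii` by name. A FACT row is an assumption label, not an endorsement.
-/

namespace Literature.IUT.HodgeArakelov

universe u

variable {S : BadPlaceSetting.{u}} {P : TopGroup.{u}} {T : TemperedCoverings S P}
  {D : EtaleThetaData S.toThetaSetting P} {Dec : SubgraphDecomposition S T D}

/-- If the `ι`-action of a (frozen, v1) `IotaInvariantTheta` datum fixes `θ(Π_v)` POINTWISE, then the orbit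
clause forces all of `θ(Π_v)` into a single `2l`-torsion class: `2l·(t' − t) = 0` for all `t, t' ∈ θ(Π_v)`.
[claim: Mochizuki2012, status: disputed] (IUTchII §2 Prop 2.2 (ii), kurims p.66)
[cite: Mochizuki2012, II Prop 2.2 (ii) p.66] -/
theorem IotaInvariantTheta.smul_sub_eq_zero_of_forall_fixed (Θ : IotaInvariantTheta Dec)
    (hfix : ∀ t ∈ D.theta, Θ.iotaH1 t = t) {t t' : D.coh.H1 ⊤} (ht : t ∈ D.theta)
    (ht' : t' ∈ D.theta) : (2 * S.l) • (t' - t) = 0 :=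
  Θ.thetaIota_orbit t ht t' ht' (hfix t ht) (hfix t' ht')

/-- **Criterion.** If every additive automorphism of `H¹(Π_Ÿ(Π_v), (l·Δ_Θ)(Π_v))` that preserves `θ(Π_v)`
fixes `θ(Π_v)` pointwise, and `θ(Π_v)` contains two classes `t, t'` with `2l·(t' − t) ≠ 0`, then the frozen
v1 statement `Prop22_ii Dec` fails (for every Prop 2.2 (i) datum `Dec`).
[claim: Mochizuki2012, status: disputed] (IUTchII §2 Prop 2.2 (ii), kurims p.66)
[cite: Mochizuki2012, II Prop 2.2 (ii) p.66] -/
theorem not_prop22_ii_of_forall_fixed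
    (hrig : ∀ ι : D.coh.H1 ⊤ ≃+ D.coh.H1 ⊤, ι '' D.theta = D.theta → ∀ t ∈ D.theta, ι t = t)
    {t t' : D.coh.H1 ⊤} (ht : t ∈ D.theta) (ht' : t' ∈ D.theta) (hne : (2 * S.l) • (t' - t) ≠ 0) :
    ¬ Prop22_ii Dec := by
  rintro ⟨Θ⟩
  exact hne (Θ.smul_sub_eq_zero_of_forall_fixed (hrig Θ.iotaH1 Θ.iota_theta) ht ht')

/-- **F-0675, universal closure REFUTED.** The frozen v1 `Prop22_ii` does NOT hold for all
`(S, P, T, D, Dec)`: over the degenerate bad-place stack (all tempered/Galois groups trivial, `l = 3`;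
`PlusMinusTower.nonempty_degenerate`) take the Prop 1.4 output with `H¹ = lim = ℤ` and orbit `{0, 1}`, so that
`θ(Π_v) = {b | ∃ o ∈ {0,1}, l·(b + o) = 0} = {0, −1}`, and the trivial Prop 2.2 (i) datum
(`exists_subgraphDecomposition_trivial`). Any additive automorphism of `ℤ` preserving `{0, −1}` fixes `−1`
(it fixes `0` and is injective), so by `not_prop22_ii_of_forall_fixed` with `t = 0`, `t' = −1`
(`2l·(−1) ≠ 0`) there is no v1 `IotaInvariantTheta`. [claim: Mochizuki2012, status: disputed]
(IUTchII §2 Prop 2.2 (ii), kurims p.66) [cite: Mochizuki2012, II Prop 2.2 (ii) p.66] -/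
theorem not_forall_prop22_ii :
    ¬ ∀ {S : BadPlaceSetting.{0}} {P : TopGroup.{0}} {T : TemperedCoverings S P}
        {D : EtaleThetaData S.toThetaSetting P} (Dec : SubgraphDecomposition S T D), Prop22_ii Dec := by
  intro h
  obtain ⟨S, P, T, -⟩ := PlusMinusTower.nonempty_degenerate
  have hl : (S.l : ℤ) ≠ 0 := Nat.cast_ne_zero.mpr S.l_prime.ne_zero
  -- the degenerate Prop 1.4 output over `(S, P)`: `H¹ = lim = ℤ`, orbit `{0, 1}`
  let D : EtaleThetaData S.toThetaSetting P :=
    { isoRef := T.isoRef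
      PiYddRef := ⊤
      PiYdd := ⊤
      isOpen_PiYdd := isOpen_univ
      PiYdd_corresponds := fun e => by
        rw [← MonoidHom.range_eq_map, MonoidHom.range_eq_top]
        exact e.surjective
      lDeltaTheta := { top := ⊥, bot := ⊥, le := le_rfl, normal := inferInstance }
      coh :=
        { H1 := fun _ => ℤ
          res := fun _ => AddMonoidHom.id ℤ
          lim := ℤ
          toLim := fun _ => AddMonoidHom.id ℤ
          toLim_res := fun _ _ => rfl }
      orbit := {0, 1}
      orbit_nonempty := ⟨0, Or.inl rfl⟩
      theta := {b : ℤ | ∃ o ∈ ({0, 1} : Set ℤ), (S.l : ℕ) • (b + o) = 0}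
      theta_eq := rfl }
  obtain ⟨Dec, -⟩ := exists_subgraphDecomposition_trivial T D
  -- membership in `θ(Π_v) = {0, -1}`
  have hmem : ∀ b : ℤ, b ∈ D.theta ↔ b = 0 ∨ b = -1 := by
    intro b
    change (∃ o ∈ ({0, 1} : Set ℤ), (S.l : ℕ) • (b + o) = 0) ↔ _
    simp only [Set.mem_insert_iff, Set.mem_singleton_iff, exists_eq_or_imp, exists_eq_left, add_zero,
      nsmul_eq_mul, mul_eq_zero, hl, false_or]
    constructor
    · rintro (h | h)
      · exact Or.inl h
      · exact Or.inr (by omega)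
    · rintro (h | h)
      · exact Or.inl h
      · exact Or.inr (by omega)
  have h0 : (0 : ℤ) ∈ D.theta := (hmem 0).mpr (Or.inl rfl)
  have h1 : (-1 : ℤ) ∈ D.theta := (hmem (-1)).mpr (Or.inr rfl)
  refine not_prop22_ii_of_forall_fixed (D := D) (Dec := Dec) ?_ h0 h1 ?_ (h Dec)
  · -- every `θ`-preserving additive automorphism of `ℤ` fixes `θ = {0, -1}` pointwise
    intro ι hι b hb
    rcases (hmem b).mp hb with rfl | rfl
    · exact map_zero ι
    · have himg : ι (-1) ∈ D.theta := hι ▸ Set.mem_image_of_mem ι h1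
      rcases (hmem _).mp himg with h' | h'
      · exact absurd (ι.injective (h'.trans (map_zero ι).symm)) (by norm_num)
      · exact h'
  · -- `2l • (-1 - 0) ≠ 0` in `ℤ`
    change (2 * S.l) • ((-1 : ℤ) - 0) ≠ 0
    rw [nsmul_eq_mul]
    push_cast
    omega

end Literature.IUT.HodgeArakelov
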